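import Literature.AlgebraicGeometry.Resolution.SeparablyDefectlessDenseDescent
import Literature.AlgebraicGeometry.Resolution.GeneralizedStabilityRankOneHenselized
import Literature.AlgebraicGeometry.Resolution.GeneralizedStabilityHenselizedRational
import Mathlib.FieldTheory.IsSepClosed
import Mathlib.FieldTheory.PurelyInseparable.Basic
import HarnessLib

/-!
# A separably closed valued field is dense in its purely inseparable extensions

Topic: `Literature/AlgebraicGeometry/Resolution` (valued function fields). PROVED valuation
theory for the discharge of the named facts `Kuhlmann2010SeparablyDefectlessRational_sepClosed`
(`Kuhlmann2019HenselianRationalitySteps.lean`) and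
`Kuhlmann2010SeparablyDefectlessRationalRT_sepClosed` (`Kuhlmann2019HenselianRationalityFiniteRank.lean`)
= F.-V. Kuhlmann, *Elimination of ramification I: The generalized stability theorem*, Trans. AMS
362 (2010) = arXiv:1003.5678, **Thm. 1.1, the "separably defectless" clause**, for a rational
function field `K(x)` over a separably closed `K`. The printed proof of that clause (§5, p. 20 of
the arXiv version: "A valued field is separably defectless if and only if its completion is
defectless (cf. [K6]). … By the 'defectless' version of Theorem 1.1 it follows that `(K^c.F,v)`
is a defectless field") passes through the completion; over a separably closed `K` with a
non-trivial valuation the completion may be replaced by any purely inseparable algebraic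
extension `K' ⊇ K` — in particular by the algebraic closure of `K`, which is purely inseparable
over `K` (`Algebra.IsAlgebraic.isPurelyInseparable_of_isSepClosed`) — because `K` is DENSE in
`K'`. This file proves that density (the input of `IsSeparablyDefectlessField.of_isDenseIn`,
`SeparablyDefectlessDenseDescent.lean`) and the accompanying bookkeeping:

* `exists_mem_valuation_sub_lt_of_pow_mem` — **Artin–Schreier approximation**: if `K ≤ Ω` is
  separably closed, `v` is non-trivial on `K` and `y^{p^n} ∈ K` (`p` the characteristic
  exponent), then `y` is a limit of elements of `K`: for `a = y^{p^n}` and `c ∈ K^×` small the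
  separable polynomial `X^{p^n} - cX - a` has a root `z ∈ K`, and `(z - y)^{p^n} = cz` is small.
* `isDenseIn_of_isSepClosed_of_pow_mem` — hence `K` is dense (`IsDenseIn`) in every extension
  `K' ≤ Ω` all of whose elements have some `p^n`-th power in `K`.
* `exists_pow_ringExpChar_mem_of_isAlgebraic` — over a separably closed `K` every algebraic
  element has a `p^n`-th power in `K` (Mathlib: algebraic extensions of separably closed fields
  are purely inseparable).
* `IsValueTranscendentalOver.of_pow_mem`, `IsResidueTranscendental.of_pow_mem` — a value- resp.
  residue-transcendental element over `K` stays so over such a `K'`.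

Everything here is standard ([folklore]; cf. Kuhlmann 2010, §5, p. 20, and F.-V. Kuhlmann,
*A classification of Artin–Schreier defect extensions and characterizations of defectless
fields*, Illinois J. Math. 54 (2010), §5) and PROVED; no new definitions or named facts.

## Sources

* F.-V. Kuhlmann, Trans. AMS 362 (2010) = arXiv:1003.5678: Thm. 1.1, §5 (p. 20). [Kuhlmann2010]

## Rendering notes

As in `SeparablyDefectlessDenseDescent.lean`: subfields of one valued field `(Ω, V)`;
"`v` non-trivial on `K`" = some `π ∈ K`, `π ≠ 0`, with `v(π) < 1`; "purely inseparable" is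
elementwise, `y ^ (ringExpChar Ω) ^ n ∈ K`, which in characteristic `0` means `y ∈ K`.
-/

noncomputable section

open IsLocalRing Polynomial

namespace Literature.AlgebraicGeometry.Resolution

universe u

variable {Ω : Type u} [Field Ω] (V : ValuationSubring Ω)

/-! ### Artin–Schreier approximation of `p^n`-th roots -/

section ArtinSchreier

/-- **Artin–Schreier approximation.** Let `K ≤ Ω` be separably closed, `π ∈ K^×` with
`v(π) < 1` (the valuation is non-trivial on `K`), `y ∈ Ω` with `y^{p^n} ∈ K` for the
characteristic exponent `p` of `Ω`, and `d ∈ K^×`. Then `v(y - z) < v(d)` for some `z ∈ K`.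
Proof: with `a = y^{p^n}`, `m = p^n ≥ 2` and a suitable `c ∈ K^×` of small value the polynomial
`X^m - cX - a` is separable, hence has a root `z ∈ K`; then `(z - y)^m = z^m - a = cz`, and
`v(z) ≤ max(1, v(a))` makes `v(cz) < v(d)^m`. (In characteristic `0`, or for `n = 0`, `y ∈ K`.)
[folklore] -/
theorem exists_mem_valuation_sub_lt_of_pow_mem (K : Subfield Ω) [IsSepClosed K]
    {π : Ω} (hπK : π ∈ K) (hπ0 : π ≠ 0) (hπ1 : V.valuation π < 1)
    {y : Ω} {n : ℕ} (hy : y ^ (ringExpChar Ω) ^ n ∈ K) {d : Ω} (hdK : d ∈ K) (hd0 : d ≠ 0) :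
    ∃ z ∈ K, V.valuation (y - z) < V.valuation d := by
  classical
  have hvd : 0 < V.valuation d := (Valuation.pos_iff _).mpr hd0
  -- the trivial case `y ∈ K`
  have triv : y ∈ K → ∃ z ∈ K, V.valuation (y - z) < V.valuation d := fun hyK =>
    ⟨y, hyK, by rwa [sub_self, map_zero]⟩
  obtain ⟨q, hq⟩ := ExpChar.exists Ω
  rw [ringExpChar.eq Ω q] at hy
  cases hq with
  | zero => exact triv (by simpa using hy)
  | prime hprime =>
    rename_i hchar
    rcases Nat.eq_zero_or_pos n with rfl | hn
    · exact triv (by simpa using hy)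
    haveI : Fact q.Prime := ⟨hprime⟩
    haveI : CharP K q := (K.subtype).charP K.subtype.injective q
    set m : ℕ := q ^ n with hm
    have h2m : 2 ≤ m := le_trans hprime.two_le (Nat.le_self_pow hn.ne' q)
    have hm0 : m ≠ 0 := by omega
    -- `d'` : the smaller of `d` and `1`
    obtain ⟨d', hd'K, hd'0, hd'1, hd'd⟩ : ∃ d' ∈ K, d' ≠ 0 ∧ V.valuation d' ≤ 1 ∧
        V.valuation d' ≤ V.valuation d := by
      by_cases h : V.valuation d ≤ 1
      · exact ⟨d, hdK, hd0, h, le_rfl⟩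
      · exact ⟨1, K.one_mem, one_ne_zero, by rw [map_one], by rw [map_one]; exact (not_le.mp h).le⟩
    have hvd' : 0 < V.valuation d' := (Valuation.pos_iff _).mpr hd'0
    -- `a = y^m` and `b ∈ K^×` with `v(b) ≤ 1`, `v(b) v(a) ≤ 1`
    set a : Ω := y ^ m with ha
    obtain ⟨b, hbK, hb0, hb1, hba⟩ : ∃ b ∈ K, b ≠ 0 ∧ V.valuation b ≤ 1 ∧
        V.valuation b * V.valuation a ≤ 1 := by
      by_cases h : V.valuation a ≤ 1
      · exact ⟨1, K.one_mem, one_ne_zero, by rw [map_one], by rwa [map_one, one_mul]⟩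
      · have ha0 : a ≠ 0 := fun h0 => h (by rw [h0, map_zero]; exact zero_le)
        have hva : 1 < V.valuation a := not_le.mp h
        refine ⟨a⁻¹, K.inv_mem hy, inv_ne_zero ha0, ?_, ?_⟩
        · rw [map_inv₀]; exact inv_le_one_of_one_le₀ hva.le
        · rw [map_inv₀, inv_mul_cancel₀ ((_root_.map_ne_zero _).mpr ha0)]
    -- `c = d'^m π b`
    set c : Ω := d' ^ m * π * b with hc
    have hcK : c ∈ K := K.mul_mem (K.mul_mem (K.pow_mem hd'K m) hπK) hbK
    have hc0 : c ≠ 0 := mul_ne_zero (mul_ne_zero (pow_ne_zero _ hd'0) hπ0) hb0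
    have hvc_le : V.valuation c ≤ V.valuation d' ^ m * V.valuation π := by
      rw [hc, map_mul, map_mul, map_pow]
      exact mul_le_of_le_one_right' hb1
    have hdm1 : V.valuation d' ^ m ≤ 1 := pow_le_one' hd'1 m
    have hvc1 : V.valuation c < 1 :=
      calc V.valuation c ≤ V.valuation d' ^ m * V.valuation π := hvc_le
        _ ≤ 1 * V.valuation π := mul_le_mul' hdm1 le_rfl
        _ = V.valuation π := one_mul _
        _ < 1 := hπ1
    -- a root `z ∈ K` of `X^m - cX - a`
    obtain ⟨z, hz⟩ := IsSepClosed.exists_root_C_mul_X_pow_add_C_mul_X_add_C' q m (1 : K)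
      (-⟨c, hcK⟩) (-⟨a, hy⟩) (dvd_pow_self q hn.ne') h2m
      (neg_ne_zero.mpr fun h0 => hc0 (congrArg Subtype.val h0))
    have hz' : (z : Ω) ^ m = c * z + a := by
      have := congrArg (Subtype.val : K → Ω) hz
      push_cast at this
      linear_combination this
    -- `(z - y)^m = cz`
    have hzy : ((z : Ω) - y) ^ m = c * z := by
      rw [hm, sub_pow_char_pow, ← hm, hz', ha]; ring
    -- the estimate `v(cz) < v(d')^m`
    have hkey : V.valuation (c * z) < V.valuation d' ^ m := by
      have hlt : V.valuation d' ^ m * V.valuation π < V.valuation d' ^ m := by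
        calc V.valuation d' ^ m * V.valuation π < V.valuation d' ^ m * 1 :=
              mul_lt_mul_of_pos_left hπ1 (pow_pos hvd' m)
          _ = V.valuation d' ^ m := mul_one _
      refine lt_of_le_of_lt ?_ hlt
      rw [map_mul]
      by_cases hz1 : V.valuation (z : Ω) ≤ 1
      · calc V.valuation c * V.valuation (z : Ω) ≤ V.valuation c := mul_le_of_le_one_right' hz1
          _ ≤ V.valuation d' ^ m * V.valuation π := hvc_le
      · have hz1' : 1 < V.valuation (z : Ω) := not_le.mp hz1
        -- `v(z)^m ≤ max (v c * v z) (v a)` and `v c * v z < v z ≤ v z ^ m` force `v z ^ m ≤ v a`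
        have hzm : V.valuation (z : Ω) ^ m ≤ max (V.valuation c * V.valuation (z : Ω)) (V.valuation a) := by
          rw [← map_pow, hz', ← map_mul]
          exact Valuation.map_add _ _ _
        have hzzm : V.valuation (z : Ω) ≤ V.valuation (z : Ω) ^ m := by
          obtain ⟨k, hk⟩ := Nat.exists_eq_succ_of_ne_zero hm0
          rw [hk, pow_succ']
          exact le_mul_of_one_le_right' (one_le_pow_of_one_le' hz1'.le k)
        have hczz : V.valuation c * V.valuation (z : Ω) < V.valuation (z : Ω) := by
          calc V.valuation c * V.valuation (z : Ω) < 1 * V.valuation (z : Ω) :=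
                mul_lt_mul_of_pos_right hvc1 (lt_trans zero_lt_one hz1')
            _ = V.valuation (z : Ω) := one_mul _
        have hzma : V.valuation (z : Ω) ^ m ≤ V.valuation a := by
          rcases le_max_iff.mp hzm with h | h
          · exact absurd (lt_of_le_of_lt h (lt_of_lt_of_le hczz hzzm)) (lt_irrefl _)
          · exact h
        have hza : V.valuation (z : Ω) ≤ V.valuation a := le_trans hzzm hzma
        calc V.valuation c * V.valuation (z : Ω)
            = V.valuation d' ^ m * V.valuation π * (V.valuation b * V.valuation (z : Ω)) := by
              rw [hc, map_mul, map_mul, map_pow]; simp only [mul_assoc]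
          _ ≤ V.valuation d' ^ m * V.valuation π * (V.valuation b * V.valuation a) :=
              mul_le_mul' le_rfl (mul_le_mul' le_rfl hza)
          _ ≤ V.valuation d' ^ m * V.valuation π * 1 := mul_le_mul' le_rfl hba
          _ = V.valuation d' ^ m * V.valuation π := mul_one _
    -- conclude
    refine ⟨z, z.2, lt_of_lt_of_le ?_ hd'd⟩
    rw [Valuation.map_sub_swap]
    by_contra hge
    have hge' : V.valuation d' ≤ V.valuation ((z : Ω) - y) := not_lt.mp hge
    have h1 : V.valuation ((z : Ω) - y) ^ m = V.valuation (c * z) := by rw [← map_pow, hzy]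
    have := pow_le_pow_left' hge' m
    rw [h1] at this
    exact absurd (lt_of_le_of_lt this hkey) (lt_irrefl _)

/-- **A separably closed, non-trivially valued field is dense in its purely inseparable
extensions**: if `K ≤ K' ≤ Ω`, `K` is separably closed, `v(π) < 1` for some `π ∈ K^×`, and
every element of `K'` has a `p^n`-th power in `K`, then `K` is dense in `K'` (`IsDenseIn`:
every `y ∈ K'` is approximable from `K` to within every value of `K'^×`). [folklore] -/
theorem isDenseIn_of_isSepClosed_of_pow_mem (K K' : Subfield Ω) [IsSepClosed K]
    {π : Ω} (hπK : π ∈ K) (hπ0 : π ≠ 0) (hπ1 : V.valuation π < 1)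
    (hpi : ∀ y ∈ K', ∃ n : ℕ, y ^ (ringExpChar Ω) ^ n ∈ K) : IsDenseIn V K K' := by
  intro y hy c hc hc0
  obtain ⟨n, hn⟩ := hpi y hy
  by_cases h1 : 1 ≤ V.valuation c
  · obtain ⟨z, hzK, hz⟩ :=
      exists_mem_valuation_sub_lt_of_pow_mem V K hπK hπ0 hπ1 hn K.one_mem one_ne_zero
    exact ⟨z, hzK, lt_of_lt_of_le (by rwa [map_one] at hz) h1⟩
  · obtain ⟨k, hk⟩ := hpi c hc
    have hc1 : V.valuation c ≤ 1 := (not_le.mp h1).le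
    have hd0 : c ^ (ringExpChar Ω) ^ k ≠ 0 := pow_ne_zero _ hc0
    obtain ⟨z, hzK, hz⟩ := exists_mem_valuation_sub_lt_of_pow_mem V K hπK hπ0 hπ1 hn hk hd0
    refine ⟨z, hzK, lt_of_lt_of_le hz ?_⟩
    rw [map_pow]
    obtain ⟨e, he⟩ := Nat.exists_eq_succ_of_ne_zero (expChar_pow_pos Ω (ringExpChar Ω) k).ne'
    rw [he, pow_succ']
    exact mul_le_of_le_one_right' (pow_le_one' hc1 e)

end ArtinSchreier

/-! ### Algebraic elements over a separably closed field -/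

section Algebraic

/-- Over a separably closed subfield `K ≤ Ω`, every element of `Ω` algebraic over `K` has a
`p^n`-th power in `K` (`p` the characteristic exponent): algebraic extensions of separably
closed fields are purely inseparable (Mathlib,
`Algebra.IsAlgebraic.isPurelyInseparable_of_isSepClosed`). [folklore] -/
theorem exists_pow_ringExpChar_mem_of_isAlgebraic (K : Subfield Ω) [IsSepClosed K] {y : Ω}
    (hy : IsAlgebraic K y) : ∃ n : ℕ, y ^ (ringExpChar Ω) ^ n ∈ K := by
  haveI : Algebra.IsAlgebraic K (IntermediateField.adjoin K ({y} : Set Ω)) :=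
    IntermediateField.isAlgebraic_adjoin_simple hy.isIntegral
  haveI : IsPurelyInseparable K (IntermediateField.adjoin K ({y} : Set Ω)) :=
    Algebra.IsAlgebraic.isPurelyInseparable_of_isSepClosed
  haveI : ExpChar K (ringExpChar Ω) := by
    rw [← ringExpChar_subfield_eq K]; exact ringExpChar.expChar K
  obtain ⟨n, z, hz⟩ := IsPurelyInseparable.pow_mem K (ringExpChar Ω)
    (⟨y, IntermediateField.mem_adjoin_simple_self K y⟩ : IntermediateField.adjoin K ({y} : Set Ω))
  refine ⟨n, ?_⟩
  have h := congrArg (fun t : IntermediateField.adjoin K ({y} : Set Ω) => (t : Ω)) hz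
  simp only [IntermediateField.coe_pow] at h
  -- `h : (algebraMap K K(y) z : Ω) = y ^ p ^ n`
  rw [← h]
  exact z.2

/-- The same for all elements of a subfield `K' ≤ Ω` algebraic over the separably closed `K`.
[folklore] -/
theorem forall_exists_pow_ringExpChar_mem_of_isAlgebraic (K K' : Subfield Ω) [IsSepClosed K]
    (halg : ∀ y ∈ K', IsAlgebraic K y) : ∀ y ∈ K', ∃ n : ℕ, y ^ (ringExpChar Ω) ^ n ∈ K :=
  fun y hy => exists_pow_ringExpChar_mem_of_isAlgebraic K (halg y hy)

end Algebraic

/-! ### Value- and residue-transcendence over purely inseparable extensions -/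

section Transcendence

variable {V}

/-- A value-transcendental element over `K` is value-transcendental over every `K'` all of whose
elements have a `p^n`-th power in `K`: `v(x)^k = v(c)` with `c ∈ K'` gives
`v(x)^{k p^n} = v(c^{p^n})` with `c^{p^n} ∈ K`. [folklore] -/
theorem IsValueTranscendentalOver.of_pow_mem {K K' : Subfield Ω} {x : Ω}
    (hx : IsValueTranscendentalOver V K x)
    (hpi : ∀ y ∈ K', ∃ n : ℕ, y ^ (ringExpChar Ω) ^ n ∈ K) : IsValueTranscendentalOver V K' x := by
  intro k hk c hc h
  obtain ⟨n, hn⟩ := hpi c hc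
  have hpos : 0 < k * (ringExpChar Ω) ^ n := Nat.mul_pos hk (expChar_pow_pos Ω _ n)
  refine hx (k * (ringExpChar Ω) ^ n) hpos (c ^ (ringExpChar Ω) ^ n) hn ?_
  rw [pow_mul, h, map_pow]

/-- The residue of an element of `V ∩ K'`, where every element of `K'` has a `p^n`-th power in
`K`, is algebraic over the residue field of `K`. [folklore] -/
theorem isAlgebraic_residue_of_pow_mem {K K' : Subfield Ω}
    (hpi : ∀ y ∈ K', ∃ n : ℕ, y ^ (ringExpChar Ω) ^ n ∈ K) {y : Ω} (hyK' : y ∈ K') (hyV : y ∈ V) :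
    IsAlgebraic (resField V K) (residue V ⟨y, hyV⟩) := by
  obtain ⟨n, hn⟩ := hpi y hyK'
  have hyVn : y ^ (ringExpChar Ω) ^ n ∈ V := V.pow_mem hyV _
  -- the residue of `y^{p^n}` lies in `Kv`
  have hmem : residue V ⟨y ^ (ringExpChar Ω) ^ n, hyVn⟩ ∈ resField V K :=
    residue_mem_resField V ⟨y ^ (ringExpChar Ω) ^ n, hyVn⟩ hn
  have hpow : residue V ⟨y, hyV⟩ ^ (ringExpChar Ω) ^ n =
      residue V ⟨y ^ (ringExpChar Ω) ^ n, hyVn⟩ := by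
    rw [← map_pow]; rfl
  -- root of `X^{p^n} - r̄`
  refine ⟨X ^ (ringExpChar Ω) ^ n - C ⟨_, hmem⟩, ?_, ?_⟩
  · exact (monic_X_pow_sub_C _ (expChar_pow_pos Ω _ n).ne').ne_zero
  · simp only [map_sub, map_pow, aeval_X, aeval_C]
    rw [hpow, sub_eq_zero]
    rfl

/-- A residue-transcendental element over `K` is residue-transcendental over every `K' ≥ K` all
of whose elements have a `p^n`-th power in `K` (the residue field of `K'` is algebraic over
that of `K`). [folklore] -/
theorem IsResidueTranscendental.of_pow_mem {K K' : Subfield Ω} {x : Ω} (hKK' : K ≤ K')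
    (hx : IsResidueTranscendental V K x)
    (hpi : ∀ y ∈ K', ∃ n : ℕ, y ^ (ringExpChar Ω) ^ n ∈ K) : IsResidueTranscendental V K' x := by
  obtain ⟨hxV, htr⟩ := hx
  refine ⟨hxV, ?_⟩
  -- the tower `Kv ≤ K'v ≤ Ωv`
  have hle : resField V K ≤ resField V K' := resField_mono V hKK'
  letI : Algebra (resField V K) (resField V K') := (Subfield.inclusion hle).toAlgebra
  haveI : IsScalarTower (resField V K) (resField V K') (ResidueField V) :=
    IsScalarTower.of_algebraMap_eq fun _ => rfl
  haveI : Algebra.IsAlgebraic (resField V K) (resField V K') := by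
    refine ⟨fun r => ?_⟩
    obtain ⟨z, hz, hzr⟩ := (mem_resField_iff V K' r).mp r.2
    have h := isAlgebraic_residue_of_pow_mem (V := V) hpi hz z.2
    have h' : IsAlgebraic (resField V K) (algebraMap (resField V K') (ResidueField V) r) := by
      have : (algebraMap (resField V K') (ResidueField V) r) = residue V ⟨(z : Ω), z.2⟩ := by
        change (r : ResidueField V) = _
        rw [← hzr]
      rw [this]; exact h
    exact (isAlgebraic_algebraMap_iff
      (algebraMap (resField V K') (ResidueField V)).injective).mp h'
  exact htr.extendScalars (resField V K')

end Transcendence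

end Literature.AlgebraicGeometry.Resolution

end
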